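import Mathlib
import HarnessLib

/-!
# Indefinite integration by marching rules (Davis–Rabinowitz 1984, Sect. 2.13)

Davis–Rabinowitz, *Methods of Numerical Integration* (2nd ed., 1984), Sect. 2.13 "Indefinite Integration", pp. 152–153:
the computation of `F(x) = ∫_a^x f(t) dt` (2.13.1), viewed either as a definite integral over a variable range or as the
solution of `F' = f, F(a) = 0` (2.13.3).  Recorded here:

* the "overhanging" starter rule `∫_a^{a+h} f ≈ (h/12)[5f(a) + 8f(a+h) - f(a+2h)]` (2.13.4): exact for quadratics, with
  the defect `h⁴ f‴/24` pinned on cubics;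
* the classical Runge–Kutta step for `y' = g(x, y)` (2.13.5)–(2.13.6) collapses, when `g(x, y) = f(x)`, to
  `y_{m+1} = y_m + (h/6)[f(x_m) + 4f(x_m + h/2) + f(x_m + h)]` (2.13.7), i.e. Simpson's rule on `[x_m, x_{m+1}]` (2.13.8);
* the multistep formula `y_{n+1} = ⅛[9y_n - y_{n-2} + 3h(f_{n+1} + 2f_n - f_{n-1})]` (2.13.9): for a polynomial
  integrand of degree `≤ 4` its defect is exactly `-(h⁵/40) f⁽⁴⁾` (so it is exact for cubic `f`; the printed error term
  reads `-(1/40) h⁴ f⁽⁵⁾(ξ)`, the standard form of this corrector's truncation error being `-(h⁵/40) y⁽⁵⁾(ξ)` with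
  `y' = f` — the identity below is what is certified);
* the corrector of the pair (2.13.10) with `f` independent of `y` is the trapezoidal step, and the trapezoidal
  recurrence `y_{n+1} = y_n + (h/2)[f(x_n) + f(x_{n+1})]` (2.13.11) on the text's example `∫_0^x e^t dt = e^x - 1`
  has the closed form `y_n = (h/2)(e^h + 1)/(e^h - 1) · (e^{nh} - 1)`, so that the tabulated error is
  `y_n - y(x_n) = c(h)(e^{x_n} - 1)` with `c(h) = (h/2)(e^h + 1)/(e^h - 1) - 1 > 0` (the table, `h = .1`, shows errors
  growing from `.0001` to `.0014 ≈ c(.1)(e - 1)`).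

Provenance: engines group, shared numerical engines serving client cells; rigour lives in the verifiers; every
published number belongs to a client cell's ledger, not to the engines group.  Textbook facts only (no client
numbers).
-/

namespace Literature.Analysis.Quadrature

open Finset Polynomial Real intervalIntegral

noncomputable section

/-- [folklore] `∫_a^b p = Σ_{i<n} c_i (b^{i+1} - a^{i+1})/(i+1)` for `deg p < n`. -/
private theorem integral_eval_eq_sum₁₃ (p : ℝ[X]) {n : ℕ} (hn : p.natDegree < n) (a b : ℝ) :
    ∫ x in a..b, p.eval x = ∑ i ∈ range n, p.coeff i * ((b ^ (i + 1) - a ^ (i + 1)) / (i + 1)) := by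
  simp_rw [eval_eq_sum_range' hn]
  rw [intervalIntegral.integral_finsetSum fun i _ => ?_]
  · refine Finset.sum_congr rfl fun i _ => ?_
    rw [intervalIntegral.integral_const_mul, integral_pow]
  · exact (continuous_const.mul (continuous_pow i)).intervalIntegrable _ _

/-! ### (2.13.4) the overhanging starter rule -/

/-- `(h/12)[5f(a) + 8f(a+h) - f(a+2h)] ≈ ∫_a^{a+h} f` — uses the exterior point `a + 2h`.
[cite: DavisRabinowitz1984, Sect. 2.13 (2.13.4)] -/
def overhangRule (f : ℝ → ℝ) (a h : ℝ) : ℝ :=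
  h / 12 * (5 * f a + 8 * f (a + h) - f (a + 2 * h))

/-- (2.13.4) is exact for quadratics. [cite: DavisRabinowitz1984, Sect. 2.13 (2.13.4)] -/
theorem integral_eq_overhangRule_of_natDegree_le (p : ℝ[X]) (hp : p.natDegree ≤ 2) (a h : ℝ) :
    ∫ x in a..a + h, p.eval x = overhangRule (fun x => p.eval x) a h := by
  have hn : p.natDegree < 3 := by omega
  rw [integral_eval_eq_sum₁₃ p hn, overhangRule]
  simp only [eval_eq_sum_range' hn, Finset.sum_range_succ, Finset.sum_range_zero]
  push_cast
  ring

/-- On cubics the defect of (2.13.4) is `h⁴ f‴/24` (`f‴ ≡ 6c₃`). [cite: DavisRabinowitz1984, Sect. 2.13 (2.13.4)] -/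
theorem integral_sub_overhangRule_of_natDegree_le_three (p : ℝ[X]) (hp : p.natDegree ≤ 3) (a h : ℝ) :
    (∫ x in a..a + h, p.eval x) - overhangRule (fun x => p.eval x) a h = h ^ 4 / 24 * (6 * p.coeff 3) := by
  have hn : p.natDegree < 4 := by omega
  rw [integral_eval_eq_sum₁₃ p hn, overhangRule]
  simp only [eval_eq_sum_range' hn, Finset.sum_range_succ, Finset.sum_range_zero]
  push_cast
  ring

/-! ### (2.13.5)–(2.13.8) Runge–Kutta with `g` independent of `y` is Simpson -/

section RK

variable {K : Type*} [Field K]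

/-- One step of the classical Runge–Kutta method for `y' = g(x, y)` with step `h` (2.13.5)–(2.13.6).
[cite: DavisRabinowitz1984, Sect. 2.13 (2.13.5)-(2.13.6)] -/
def rungeKuttaStep (g : K → K → K) (x y h : K) : K :=
  let k₁ := g x y
  let k₂ := g (x + h / 2) (y + h * k₁ / 2)
  let k₃ := g (x + h / 2) (y + h * k₂ / 2)
  let k₄ := g (x + h) (y + h * k₃)
  y + h / 6 * (k₁ + 2 * k₂ + 2 * k₃ + k₄)

/-- (2.13.7): when `g(x, y) = f(x)` the Runge–Kutta step is `y + (h/6)[f(x) + 4f(x + h/2) + f(x + h)]`, i.e. Simpson's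
rule on `[x, x + h]` added to `y` (2.13.8). [cite: DavisRabinowitz1984, Sect. 2.13 (2.13.7)-(2.13.8)] -/
theorem rungeKuttaStep_of_indep (f : K → K) (x y h : K) :
    rungeKuttaStep (fun t _ => f t) x y h = y + h / 6 * (f x + 4 * f (x + h / 2) + f (x + h)) := by
  simp only [rungeKuttaStep]
  ring

/-- The corrector of the predictor–corrector pair (2.13.10), `y_{m+1} = y_m + (h/2)[g(x_m, y_m) + g(x_{m+1}, ȳ_{m+1})]`.
[cite: DavisRabinowitz1984, Sect. 2.13 (2.13.10)] -/
def correctorStep (g : K → K → K) (x y h ybar : K) : K :=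
  y + h / 2 * (g x y + g (x + h) ybar)

/-- (2.13.10) with `g` independent of `y` is the trapezoidal step, whatever the predicted value.
[cite: DavisRabinowitz1984, Sect. 2.13 (2.13.10)] -/
theorem correctorStep_of_indep (f : K → K) (x y h ybar : K) :
    correctorStep (fun t _ => f t) x y h ybar = y + h / 2 * (f x + f (x + h)) := rfl

end RK

/-- (2.13.8) made quantitative: with `g = f` a polynomial of degree `≤ 3`, one Runge–Kutta step advances the exact
indefinite integral. [cite: DavisRabinowitz1984, Sect. 2.13 (2.13.8)] -/
theorem rungeKuttaStep_eq_integral_of_natDegree_le (p : ℝ[X]) (hp : p.natDegree ≤ 3) (x y h : ℝ) :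
    rungeKuttaStep (fun t _ => p.eval t) x y h = y + ∫ t in x..x + h, p.eval t := by
  have hn : p.natDegree < 4 := by omega
  rw [rungeKuttaStep_of_indep, integral_eval_eq_sum₁₃ p hn]
  simp only [eval_eq_sum_range' hn, Finset.sum_range_succ, Finset.sum_range_zero]
  push_cast
  ring

/-! ### (2.13.9) the three-step formula -/

/-- `⅛[9y_n - y_{n-2} + 3h(f_{n+1} + 2f_n - f_{n-1})]` (2.13.9), written with `y_k = Y(x_n + (k - n)h)`.
[cite: DavisRabinowitz1984, Sect. 2.13 (2.13.9)] -/
def threeStepFormula (Y f : ℝ → ℝ) (x h : ℝ) : ℝ :=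
  (9 * Y x - Y (x - 2 * h) + 3 * h * (f (x + h) + 2 * f x - f (x - h))) / 8

/-- (2.13.9) on a polynomial integrand of degree `≤ 4`, `Y(x) = ∫_a^x p`: the defect `Y(x_{n+1}) - formula` is exactly
`-(h⁵/40) p⁽⁴⁾` (`p⁽⁴⁾ ≡ 24c₄`); in particular the formula is exact for cubic integrands.
[cite: DavisRabinowitz1984, Sect. 2.13 (2.13.9)] -/
theorem integral_sub_threeStepFormula_of_natDegree_le_four (p : ℝ[X]) (hp : p.natDegree ≤ 4) (a x h : ℝ) :
    (∫ t in a..x + h, p.eval t) - threeStepFormula (fun s => ∫ t in a..s, p.eval t) (fun s => p.eval s) x h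
      = -(h ^ 5 / 40) * (24 * p.coeff 4) := by
  have hn : p.natDegree < 5 := by omega
  simp only [threeStepFormula]
  simp only [integral_eval_eq_sum₁₃ p hn]
  simp only [eval_eq_sum_range' hn, Finset.sum_range_succ, Finset.sum_range_zero]
  push_cast
  ring

/-- (2.13.9) is exact for cubic integrands. [cite: DavisRabinowitz1984, Sect. 2.13 (2.13.9)] -/
theorem integral_eq_threeStepFormula_of_natDegree_le_three (p : ℝ[X]) (hp : p.natDegree ≤ 3) (a x h : ℝ) :
    ∫ t in a..x + h, p.eval t = threeStepFormula (fun s => ∫ t in a..s, p.eval t) (fun s => p.eval s) x h := by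
  have h4 : p.coeff 4 = 0 := coeff_eq_zero_of_natDegree_lt (by omega)
  have := integral_sub_threeStepFormula_of_natDegree_le_four p (by omega) a x h
  rw [h4, mul_zero, mul_zero] at this
  linarith

/-! ### (2.13.11) the trapezoidal recurrence and the worked example `∫_0^x e^t dt` -/

/-- `y_0 = 0`, `y_{n+1} = y_n + (h/2)[f(x_n) + f(x_{n+1})]`, `x_n = x_0 + nh` (2.13.11).
[cite: DavisRabinowitz1984, Sect. 2.13 (2.13.11)] -/
def trapezoidalRecurrence (f : ℝ → ℝ) (x₀ h : ℝ) : ℕ → ℝ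
  | 0 => 0
  | n + 1 => trapezoidalRecurrence f x₀ h n + h / 2 * (f (x₀ + n * h) + f (x₀ + (n + 1) * h))

/-- The starting value `y_0 = 0` of the recurrence (2.13.11). [cite: DavisRabinowitz1984, Sect. 2.13 (2.13.11)] -/
@[simp] theorem trapezoidalRecurrence_zero (f : ℝ → ℝ) (x₀ h : ℝ) : trapezoidalRecurrence f x₀ h 0 = 0 := rfl

/-- The step `y_{n+1} = y_n + (h/2)[f(x_n) + f(x_{n+1})]` of the recurrence (2.13.11).
[cite: DavisRabinowitz1984, Sect. 2.13 (2.13.11)] -/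
theorem trapezoidalRecurrence_succ (f : ℝ → ℝ) (x₀ h : ℝ) (n : ℕ) :
    trapezoidalRecurrence f x₀ h (n + 1)
      = trapezoidalRecurrence f x₀ h n + h / 2 * (f (x₀ + n * h) + f (x₀ + (n + 1) * h)) := rfl

/-- The recurrence tabulates the composite trapezoidal sums. [cite: DavisRabinowitz1984, Sect. 2.13 (2.13.11)] -/
theorem trapezoidalRecurrence_eq_sum (f : ℝ → ℝ) (x₀ h : ℝ) (n : ℕ) :
    trapezoidalRecurrence f x₀ h n = ∑ k ∈ range n, h / 2 * (f (x₀ + k * h) + f (x₀ + (k + 1) * h)) := by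
  induction n with
  | zero => simp
  | succ n ih => rw [trapezoidalRecurrence_succ, ih, Finset.sum_range_succ]

/-- The text's example `y(x) = ∫_0^x e^t dt` by (2.13.11): closed form `y_n = (h/2)(e^h + 1)/(e^h - 1)(e^{nh} - 1)`
(`h ≠ 0`). [cite: DavisRabinowitz1984, Sect. 2.13 (2.13.11)] -/
theorem trapezoidalRecurrence_exp (h : ℝ) (hh : h ≠ 0) (n : ℕ) :
    trapezoidalRecurrence exp 0 h n = h / 2 * ((exp h + 1) / (exp h - 1)) * (exp (n * h) - 1) := by
  have hd : exp h - 1 ≠ 0 := by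
    intro h0
    have : exp h = exp 0 := by rw [Real.exp_zero]; linarith
    exact hh (exp_injective this)
  induction n with
  | zero => simp
  | succ n ih =>
    rw [trapezoidalRecurrence_succ, ih, zero_add, zero_add]
    have e1 : exp ((n + 1 : ℕ) * h) = exp (n * h) * exp h := by
      rw [← Real.exp_add]; congr 1; push_cast; ring
    have e2 : exp (((n : ℝ) + 1) * h) = exp (n * h) * exp h := by
      rw [← Real.exp_add]; congr 1; ring
    rw [e1, e2]
    field_simp
    ring

/-- Hence the tabulated error is proportional to `e^{x_n} - 1`:
`y_n - (e^{nh} - 1) = c(h)(e^{nh} - 1)` with `c(h) = (h/2)(e^h + 1)/(e^h - 1) - 1`.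
[cite: DavisRabinowitz1984, Sect. 2.13 (2.13.11)] -/
theorem trapezoidalRecurrence_exp_sub (h : ℝ) (hh : h ≠ 0) (n : ℕ) :
    trapezoidalRecurrence exp 0 h n - (exp (n * h) - 1)
      = (h / 2 * ((exp h + 1) / (exp h - 1)) - 1) * (exp (n * h) - 1) := by
  rw [trapezoidalRecurrence_exp h hh n]
  ring

/-- The error constant is positive for `h > 0`: `e^h - 1 < (h/2)(e^h + 1)` (the trapezoidal rule overestimates the
convex integrand `e^t`), so every tabulated error is positive. [cite: DavisRabinowitz1984, Sect. 2.13 (2.13.11)] -/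
theorem exp_sub_one_lt_half_mul (h : ℝ) (hh : 0 < h) : exp h - 1 < h / 2 * (exp h + 1) := by
  -- φ(t) = (t/2)(e^t + 1) - e^t + 1 has φ(0) = 0 and φ'(t) = (1 + (t - 1)e^t)/2 > 0 for t > 0.
  let φ : ℝ → ℝ := fun t => t / 2 * (exp t + 1) - exp t + 1
  have hderiv : ∀ t, HasDerivAt φ ((1 + (t - 1) * exp t) / 2) t := by
    intro t
    have h1 : HasDerivAt (fun t => t / 2 * (exp t + 1)) (1 / 2 * (exp t + 1) + t / 2 * exp t) t := by
      have ha : HasDerivAt (fun t : ℝ => t / 2) (1 / 2) t := by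
        simpa using (hasDerivAt_id t).div_const 2
      have hb : HasDerivAt (fun t => exp t + 1) (exp t) t := by
        simpa using (Real.hasDerivAt_exp t).add_const 1
      exact (ha.mul hb).congr_deriv (by ring)
    have h2 : HasDerivAt (fun t => t / 2 * (exp t + 1) - exp t + 1) (1 / 2 * (exp t + 1) + t / 2 * exp t - exp t) t :=
      (h1.sub (Real.hasDerivAt_exp t)).add_const 1
    convert h2 using 1; ring
  have hpos : ∀ t, 0 < t → 0 < (1 + (t - 1) * exp t) / 2 := by
    intro t ht
    have : (1 - t) * exp t < 1 := by
      rcases le_or_gt 1 t with h1 | h1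
      · calc (1 - t) * exp t ≤ 0 := mul_nonpos_of_nonpos_of_nonneg (by linarith) (exp_pos t).le
          _ < 1 := one_pos
      · have hlt : 1 - t < exp (-t) := by
          have := Real.one_sub_lt_exp_neg ht.ne'
          simpa using this
        calc (1 - t) * exp t < exp (-t) * exp t := by gcongr
          _ = 1 := by rw [← Real.exp_add]; simp
    nlinarith
  have hmono : StrictMonoOn φ (Set.Ici 0) := by
    refine strictMonoOn_of_deriv_pos (convex_Ici 0) ?_ ?_
    · exact fun t _ => (hderiv t).continuousAt.continuousWithinAt
    · intro t ht
      rw [interior_Ici, Set.mem_Ioi] at ht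
      rw [(hderiv t).deriv]; exact hpos t ht
  have h0 : φ 0 = 0 := by simp [φ]
  have := hmono (Set.mem_Ici.2 le_rfl) (Set.mem_Ici.2 hh.le) hh
  rw [h0] at this
  simp only [φ] at this
  linarith

/-- So `y_n > e^{nh} - 1` for every `n ≥ 1`, `h > 0` (all errors in the table are positive).
[cite: DavisRabinowitz1984, Sect. 2.13 (2.13.11)] -/
theorem exp_sub_one_lt_trapezoidalRecurrence_exp (h : ℝ) (hh : 0 < h) (n : ℕ) (hn : 1 ≤ n) :
    exp (n * h) - 1 < trapezoidalRecurrence exp 0 h n := by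
  have hc : 0 < h / 2 * ((exp h + 1) / (exp h - 1)) - 1 := by
    have hd : 0 < exp h - 1 := by have := Real.add_one_lt_exp hh.ne'; linarith
    rw [sub_pos, ← mul_div_assoc, lt_div_iff₀ hd, one_mul]
    exact exp_sub_one_lt_half_mul h hh
  have he : 0 < exp (n * h) - 1 := by
    have : (0:ℝ) < n * h := mul_pos (by exact_mod_cast hn) hh
    have := Real.add_one_lt_exp this.ne'
    linarith
  have := trapezoidalRecurrence_exp_sub h hh.ne' n
  nlinarith [mul_pos hc he]

end

end Literature.Analysis.Quadrature
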